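import Literature.Probability.FitznerVanDerHofstad2017.NobleSymmetry
import Literature.Barriers.CriticalPhenomena.LaceExpansionKernelTaylor
import HarnessLib

/-!
# Fitzner–van der Hofstad [NoBLE17] Lemma 2.12 ("Fourier transforms and step distributions") and the
# App. D Step 5 mechanism behind (D.32)

[NoBLE17] = R. Fitzner, R. van der Hofstad, *Generalized approach to the non-backtracking lace expansion*,
Probab. Theory Relat. Fields 169 (2017) 1041–1119 (arXiv:1506.07969).

* **Lemma 2.12** (PTRF p. 1063, proof App. A p. 1105), VERBATIM: "For a summable, non-negative function `g`
  that is totally rotationally symmetric, as defined in Definition 2.5, the following bound holds: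
  `Σ_x g(x)[1 − cos(k·x)] ≤ [1 − D̂(k)] Σ_x g(x)‖x‖₂²`."  Here: `tsum_mul_one_sub_cos_kdot_le` (hypothesis
  `IsZdSymmetric`, the tree's signed-coordinate-permutation invariance of [Hara2008] §1.1) and
  `tsum_mul_one_sub_cos_kdot_le_of_isTRS` / `cosFT_zero_sub_le_of_isTRS` (hypothesis `IsTRS` = [NoBLE17]
  Def. 2.5 as typed in `NobleAssumptions`; the two notions coincide: `isTRS_iff_isZdSymmetric`).  The printed
  proof (telescoping of `1 − e^{ik·x}` and "reordering the sum using the symmetry of `g`") is implemented as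
  an induction over the coordinates with the identity
  `1 − cos(a+b) = (1 − cos a) + (1 − cos b) − (1 − cos a)(1 − cos b) + sin a · sin b`, whose last term has
  vanishing `g`-weighted sum by the reflection `x_j ↦ −x_j` (an odd summand), followed by
  `1 − cos(nt) ≤ n²(1 − cos t)` (`one_sub_cos_int_mul_le`) and the isotropy of second moments
  (`tsum_sq_apply_mul_eq` of `LaceExpansionKernelTaylor`).  The weighted summability `Σ_x ‖x‖₂² g(x) < ∞`
  is an explicit hypothesis (the print leaves it implicit; for a divergent second moment the bound is void).
  Compare `one_sub_re_latticeFT_le` (ibid.), the weaker Taylor form with `|k|²/(2d)` in place of `1 − D̂(k)`;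
  Lemma 2.13 (2.26) ("Split of cosines") is the tree's `HvdH2017_lemma73`.
* **(2.24), second form** (PTRF p. 1063): `‖Σ_{i=1}^J x_i‖₂² ≤ J Σ_i ‖x_i‖₂²` (`euclidNorm_sq_sum_le`).
* **App. D Step 5** (PTRF p. 1117, (D.32)): "we note that `[1 − cos(k·x)] ≥ 0` for all `k` and `x`", so
  that for a remainder `R` with a non-negative, symmetric minorant `−m ≤ R`,
  `R̂(0) − R̂(k) = Σ_x R(x)[1 − cos(k·x)] ≥ −[1 − D̂(k)] Σ_x ‖x‖₂² m(x)` (`cosFT_zero_sub_ge_of_minorant`), and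
  with `Σ_x ‖x‖₂² m(x) ≤ β`: `−β(1 − D̂(k)) ≤ R̂(0) − R̂(k)` (`displacement_lower_bound`) — literally the shape of
  the last conjunct of `NobleSimplifiedFormAt` (`β = β_{ΔR_F}`, `R = R_F`) and of the hypothesis `hΔ` of
  `nobleSimplifiedFormAt_of_assumptions` (`NobleKSpaceRewrite`).

No `sorry`, no named facts.  b2b-lace analytic oracle gen 6, node N33-V1(a)-AppD, module 3a.

[cite: FitznerVanDerHofstad2016NoBLE, Def. 2.5 (p. 1058); Lemma 2.12 (2.23) (p. 1063); (2.24) (p. 1063);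
App. A (proof of Lemma 2.12) (p. 1105); App. D Step 5 (D.32) (p. 1117)]
-/

noncomputable section

namespace Literature.Probability.FitznerVanDerHofstad2017

open _root_.Filter _root_.Topology Literature.Probability.LatticeModels Literature.Probability.Percolation
  Literature.Barriers.CriticalPhenomena
open scoped BigOperators

variable {d : ℕ}

/-! ## Trigonometric inequalities: `1 − cos(nt) ≤ n²(1 − cos t)` and the one-step identity -/

section Trig

/-- `1 − cos(nt) ≤ n²(1 − cos t)` for `n ∈ ℕ`. [cite: FitznerVanDerHofstad2016NoBLE, App. A, proof of
Lemma 2.12 ("We use `1 − cos(nt) ≤ n²[1 − cos(t)]`") (p. 1105)] -/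
theorem one_sub_cos_nat_mul_le (n : ℕ) (t : ℝ) : 1 - Real.cos (n * t) ≤ (n : ℝ) ^ 2 * (1 - Real.cos t) := by
  -- `|sin(n s)| ≤ n |sin s|` (induction on `n`; also in the tree's Balaban B5 leaves, not imported here)
  have key : ∀ (n : ℕ) (s : ℝ), |Real.sin (n * s)| ≤ n * |Real.sin s| := by
    intro n s
    induction n with
    | zero => simp
    | succ n ih =>
      have h1 : Real.sin ((n + 1 : ℕ) * s) = Real.sin (n * s) * Real.cos s + Real.cos (n * s) * Real.sin s := by
        rw [Nat.cast_succ, add_mul, one_mul, Real.sin_add]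
      rw [h1, Nat.cast_succ]
      calc |Real.sin (n * s) * Real.cos s + Real.cos (n * s) * Real.sin s|
          ≤ |Real.sin (n * s) * Real.cos s| + |Real.cos (n * s) * Real.sin s| := abs_add_le _ _
        _ = |Real.sin (n * s)| * |Real.cos s| + |Real.cos (n * s)| * |Real.sin s| := by rw [abs_mul, abs_mul]
        _ ≤ |Real.sin (n * s)| * 1 + 1 * |Real.sin s| :=
            add_le_add (mul_le_mul_of_nonneg_left (Real.abs_cos_le_one s) (abs_nonneg _))
              (mul_le_mul_of_nonneg_right (Real.abs_cos_le_one _) (abs_nonneg _))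
        _ ≤ n * |Real.sin s| + |Real.sin s| := by linarith
        _ = (n + 1) * |Real.sin s| := by ring
  rw [one_sub_cos_eq_two_mul_sin_sq, one_sub_cos_eq_two_mul_sin_sq t]
  have h := key n (t / 2)
  rw [show (n : ℝ) * t / 2 = n * (t / 2) by ring]
  have h0 : 0 ≤ |Real.sin (n * (t / 2))| := abs_nonneg _
  calc 2 * Real.sin (n * (t / 2)) ^ 2 = 2 * |Real.sin (n * (t / 2))| ^ 2 := by rw [sq_abs]
    _ ≤ 2 * (n * |Real.sin (t / 2)|) ^ 2 := by
        have := pow_le_pow_left₀ h0 h 2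
        linarith
    _ = (n : ℝ) ^ 2 * (2 * Real.sin (t / 2) ^ 2) := by rw [mul_pow, sq_abs]; ring

/-- `1 − cos(nt) ≤ n²(1 − cos t)` for `n ∈ ℤ`. [cite: FitznerVanDerHofstad2016NoBLE, App. A, proof of
Lemma 2.12 (p. 1105)] -/
theorem one_sub_cos_int_mul_le (n : ℤ) (t : ℝ) : 1 - Real.cos (n * t) ≤ (n : ℝ) ^ 2 * (1 - Real.cos t) := by
  obtain ⟨m, hm | hm⟩ := Int.eq_nat_or_neg n
  · subst hm; exact_mod_cast one_sub_cos_nat_mul_le m t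
  · subst hm
    have h := one_sub_cos_nat_mul_le m t
    rw [Int.cast_neg, Int.cast_natCast, neg_mul, Real.cos_neg, neg_sq]
    exact h

/-- **[NoBLE17] (2.24), second form**: `‖Σ_{i=1}^J x_i‖₂² ≤ J Σ_{i=1}^J ‖x_i‖₂²` for `x_i ∈ ℤ^d`.
[cite: FitznerVanDerHofstad2016NoBLE, (2.24) (p. 1063)] -/
theorem euclidNorm_sq_sum_le {ι : Type*} (s : Finset ι) (x : ι → Site d) :
    euclidNorm (∑ i ∈ s, x i) ^ 2 ≤ s.card * ∑ i ∈ s, euclidNorm (x i) ^ 2 := by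
  rw [euclidNorm_sq]
  have h : ∀ i ∈ s, euclidNorm (x i) ^ 2 = ∑ j, ((x i j : ℤ) : ℝ) ^ 2 := fun i _ => euclidNorm_sq (x i)
  rw [Finset.sum_congr rfl h, Finset.sum_comm, Finset.mul_sum]
  refine Finset.sum_le_sum fun j _ => ?_
  have : (((∑ i ∈ s, x i) j : ℤ) : ℝ) = ∑ i ∈ s, ((x i j : ℤ) : ℝ) := by
    rw [Finset.sum_apply]; push_cast; rfl
  rw [this]
  exact sq_sum_le_card_mul_sum_sq

/-- The one-step identity behind the telescoping of `1 − e^{ik·x}`: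
`1 − cos(a+b) = (1 − cos a) + (1 − cos b) − (1 − cos a)(1 − cos b) + sin a sin b`. [folklore] -/
theorem one_sub_cos_add_eq (a b : ℝ) :
    1 - Real.cos (a + b) =
      (1 - Real.cos a) + (1 - Real.cos b) - (1 - Real.cos a) * (1 - Real.cos b) + Real.sin a * Real.sin b := by
  rw [Real.cos_add]; ring

/-- Hence `1 − cos(a+b) ≤ (1 − cos a) + (1 − cos b) + sin a sin b`. [folklore] -/
theorem one_sub_cos_add_le_add_sin_mul (a b : ℝ) :
    1 - Real.cos (a + b) ≤ (1 - Real.cos a) + (1 - Real.cos b) + Real.sin a * Real.sin b := by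
  rw [one_sub_cos_add_eq]
  nlinarith [Real.cos_le_one a, Real.cos_le_one b]

/-- `|1 − cos t| ≤ 2`. [folklore] -/
theorem abs_one_sub_cos_le_two (t : ℝ) : |1 - Real.cos t| ≤ 2 := by
  rw [abs_of_nonneg (by linarith [Real.cos_le_one t])]
  linarith [Real.neg_one_le_cos t]

end Trig

/-! ## `IsTRS` ([NoBLE17] Def. 2.5) is `IsZdSymmetric` ([Hara2008] §1.1) -/

section Bridge

/-- A totally rotationally symmetric function (Def. 2.5, via `siteSymm`) is `ℤ^d`-symmetric (invariant under
the signed coordinate permutations `Site.signedPerm`). [cite: FitznerVanDerHofstad2016NoBLE, Def. 2.5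
(p. 1058)] -/
theorem IsTRS.isZdSymmetric {f : Site d → ℝ} (h : IsTRS f) : IsZdSymmetric f := by
  intro π ε x
  have hε : (fun j => if decide (ε j = 1) = true then (1 : ℤˣ) else -1) = ε := by
    funext j
    rcases Int.units_eq_one_or (ε j) with hε | hε <;> simp [hε]
  have e : siteSymm π.symm (fun j => decide (ε j = 1)) x = Site.signedPerm π ε x := by
    rw [siteSymm_eq_signedPerm, zdSignedPermIso_apply, Equiv.symm_symm, hε]
  rw [← e]; exact h _ _ x

/-- Conversely, a `ℤ^d`-symmetric function is totally rotationally symmetric.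
[cite: FitznerVanDerHofstad2016NoBLE, Def. 2.5 (p. 1058)] -/
theorem IsZdSymmetric.isTRS {f : Site d → ℝ} (h : IsZdSymmetric f) : IsTRS f := by
  intro ν δ x
  rw [siteSymm_eq_signedPerm, zdSignedPermIso_apply]
  exact h _ _ x

/-- `IsTRS f ↔ IsZdSymmetric f`. [cite: FitznerVanDerHofstad2016NoBLE, Def. 2.5 (p. 1058)] -/
theorem isTRS_iff_isZdSymmetric {f : Site d → ℝ} : IsTRS f ↔ IsZdSymmetric f :=
  ⟨IsTRS.isZdSymmetric, IsZdSymmetric.isTRS⟩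

end Bridge

/-! ## [NoBLE17] Lemma 2.12 -/

section Lemma212

/-- Summability of `x ↦ g(x)·b(x)` for `g ≥ 0` summable and a bounded factor `|b| ≤ C`. [folklore] -/
theorem summable_mul_of_nonneg_of_abs_le {g b : Site d → ℝ} (hg : Summable g) (hg0 : ∀ x, 0 ≤ g x) {C : ℝ}
    (hb : ∀ x, |b x| ≤ C) : Summable fun x => g x * b x :=
  Summable.of_norm_bounded (hg.mul_left C) fun x => by
    rw [Real.norm_eq_abs, abs_mul, abs_of_nonneg (hg0 x), mul_comm C]
    exact mul_le_mul_of_nonneg_left (hb x) (hg0 x)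

/-- A summand that is odd under a bijection of `ℤ^d` has `tsum` zero. [folklore] -/
theorem tsum_eq_zero_of_odd_equiv (σ : Site d ≃ Site d) {h : Site d → ℝ} (hodd : ∀ x, h (σ x) = -h x) :
    ∑' x, h x = 0 := by
  have e := Equiv.tsum_eq σ h
  rw [show (fun x => h (σ x)) = fun x => -h x from funext hodd, tsum_neg] at e
  linarith

/-- The reflection of the coordinate `j` as a signed permutation: `ε = 1` off `j`, `ε_j = −1`. Values.
[folklore] -/
theorem signedPerm_reflect_apply (j : Fin d) (x : Site d) (i : Fin d) :
    Site.signedPerm (Equiv.refl (Fin d)) (Function.update (fun _ => (1 : ℤˣ)) j (-1)) x i =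
      if i = j then -x i else x i := by
  rw [Site.signedPerm_apply, Equiv.refl_symm, Equiv.refl_apply]
  by_cases h : i = j
  · subst h; simp
  · simp [h]

/-- The coordinate induction of the proof of Lemma 2.12: for `g ≥ 0` summable and `ℤ^d`-symmetric,
`Σ_x g(x)[1 − cos(Σ_{j∈S} k_j x_j)] ≤ Σ_{j∈S} Σ_x g(x)[1 − cos(k_j x_j)]` ("We reorder the sum over `x` using
the symmetry of `x ↦ g(x)`"). [cite: FitznerVanDerHofstad2016NoBLE, App. A, proof of Lemma 2.12, first
display (p. 1105)] -/
theorem tsum_mul_one_sub_cos_partial_le {g : Site d → ℝ} (hg : Summable g) (hg0 : ∀ x, 0 ≤ g x)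
    (hsym : IsZdSymmetric g) (k : Fin d → ℝ) (S : Finset (Fin d)) :
    ∑' x, g x * (1 - Real.cos (∑ j ∈ S, k j * (x j : ℝ))) ≤
      ∑ j ∈ S, ∑' x, g x * (1 - Real.cos (k j * (x j : ℝ))) := by
  classical
  induction S using Finset.induction_on with
  | empty => simp
  | insert j T hj ih =>
    rw [Finset.sum_insert hj]
    have hpt : ∀ x, g x * (1 - Real.cos (∑ i ∈ insert j T, k i * (x i : ℝ))) ≤
        g x * (1 - Real.cos (k j * (x j : ℝ))) + g x * (1 - Real.cos (∑ i ∈ T, k i * (x i : ℝ))) +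
          g x * (Real.sin (k j * (x j : ℝ)) * Real.sin (∑ i ∈ T, k i * (x i : ℝ))) := by
      intro x
      rw [Finset.sum_insert hj, ← mul_add, ← mul_add]
      exact mul_le_mul_of_nonneg_left (one_sub_cos_add_le_add_sin_mul _ _) (hg0 x)
    -- summabilities
    have hs1 : Summable fun x => g x * (1 - Real.cos (k j * (x j : ℝ))) :=
      summable_mul_of_nonneg_of_abs_le hg hg0 fun x => abs_one_sub_cos_le_two _
    have hsT : Summable fun x => g x * (1 - Real.cos (∑ i ∈ T, k i * (x i : ℝ))) :=
      summable_mul_of_nonneg_of_abs_le hg hg0 fun x => abs_one_sub_cos_le_two _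
    have hsI : Summable fun x => g x * (1 - Real.cos (∑ i ∈ insert j T, k i * (x i : ℝ))) :=
      summable_mul_of_nonneg_of_abs_le hg hg0 fun x => abs_one_sub_cos_le_two _
    have hsS : Summable fun x => g x * (Real.sin (k j * (x j : ℝ)) * Real.sin (∑ i ∈ T, k i * (x i : ℝ))) :=
      summable_mul_of_nonneg_of_abs_le hg hg0 (C := 1) fun x => by
        rw [abs_mul]
        calc |Real.sin (k j * (x j : ℝ))| * |Real.sin (∑ i ∈ T, k i * (x i : ℝ))| ≤ 1 * 1 :=
              mul_le_mul (Real.abs_sin_le_one _) (Real.abs_sin_le_one _) (abs_nonneg _) zero_le_one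
          _ = 1 := one_mul 1
    -- the odd term vanishes under the reflection `x_j ↦ −x_j`
    have hodd : ∑' x, g x * (Real.sin (k j * (x j : ℝ)) * Real.sin (∑ i ∈ T, k i * (x i : ℝ))) = 0 := by
      set σ := Site.signedPerm (Equiv.refl (Fin d)) (Function.update (fun _ => (1 : ℤˣ)) j (-1)) with hσ
      refine tsum_eq_zero_of_odd_equiv σ fun x => ?_
      have hT' : ∑ i ∈ T, k i * ((σ x i : ℤ) : ℝ) = ∑ i ∈ T, k i * (x i : ℝ) :=
        Finset.sum_congr rfl fun i hi => by
          rw [hσ, signedPerm_reflect_apply, if_neg (ne_of_mem_of_not_mem hi hj)]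
      have hj' : ((σ x j : ℤ) : ℝ) = -(x j : ℝ) := by
        rw [hσ, signedPerm_reflect_apply, if_pos rfl, Int.cast_neg]
      rw [hsym _ _ x, hT', hj', mul_neg, Real.sin_neg]
      ring
    calc ∑' x, g x * (1 - Real.cos (∑ i ∈ insert j T, k i * (x i : ℝ)))
        ≤ ∑' x, (g x * (1 - Real.cos (k j * (x j : ℝ))) + g x * (1 - Real.cos (∑ i ∈ T, k i * (x i : ℝ))) +
            g x * (Real.sin (k j * (x j : ℝ)) * Real.sin (∑ i ∈ T, k i * (x i : ℝ)))) :=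
          hsI.tsum_le_tsum hpt ((hs1.add hsT).add hsS)
      _ = ∑' x, g x * (1 - Real.cos (k j * (x j : ℝ))) + ∑' x, g x * (1 - Real.cos (∑ i ∈ T, k i * (x i : ℝ))) +
            ∑' x, g x * (Real.sin (k j * (x j : ℝ)) * Real.sin (∑ i ∈ T, k i * (x i : ℝ))) := by
          rw [(hs1.add hsT).tsum_add hsS, hs1.tsum_add hsT]
      _ ≤ ∑' x, g x * (1 - Real.cos (k j * (x j : ℝ))) + ∑ i ∈ T, ∑' x, g x * (1 - Real.cos (k i * (x i : ℝ))) := by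
          rw [hodd, add_zero]; exact add_le_add le_rfl ih

/-- Per coordinate: `Σ_x g(x)[1 − cos(k_j x_j)] ≤ [1 − cos k_j] Σ_x x_j² g(x)` (from
`1 − cos(nt) ≤ n²[1 − cos t]`). [cite: FitznerVanDerHofstad2016NoBLE, App. A, proof of Lemma 2.12, second
display (p. 1105)] -/
theorem tsum_mul_one_sub_cos_coord_le {g : Site d → ℝ} (hg : Summable g) (hg0 : ∀ x, 0 ≤ g x)
    (hgw : ∀ j, Summable fun x => ((x j : ℤ) : ℝ) ^ 2 * g x) (k : Fin d → ℝ) (j : Fin d) :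
    ∑' x, g x * (1 - Real.cos (k j * (x j : ℝ))) ≤ (1 - Real.cos (k j)) * ∑' x, ((x j : ℤ) : ℝ) ^ 2 * g x := by
  rw [← tsum_mul_left]
  refine (summable_mul_of_nonneg_of_abs_le hg hg0 fun x => abs_one_sub_cos_le_two _).tsum_le_tsum
    (fun x => ?_) ((hgw j).mul_left _)
  have h := one_sub_cos_int_mul_le (x j) (k j)
  rw [mul_comm ((x j : ℤ) : ℝ) (k j)] at h
  calc g x * (1 - Real.cos (k j * (x j : ℝ))) ≤ g x * (((x j : ℤ) : ℝ) ^ 2 * (1 - Real.cos (k j))) :=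
        mul_le_mul_of_nonneg_left h (hg0 x)
    _ = (1 - Real.cos (k j)) * (((x j : ℤ) : ℝ) ^ 2 * g x) := by ring

/-- Weighted summability per coordinate from `Σ_x ‖x‖₂² g(x) < ∞`. [folklore] -/
theorem summable_sq_coord_mul {g : Site d → ℝ} (hg0 : ∀ x, 0 ≤ g x)
    (hgw : Summable fun x => euclidNorm x ^ 2 * g x) (j : Fin d) :
    Summable fun x => ((x j : ℤ) : ℝ) ^ 2 * g x := by
  refine Summable.of_nonneg_of_le (fun x => mul_nonneg (sq_nonneg _) (hg0 x)) (fun x => ?_) hgw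
  rw [euclidNorm_sq]
  exact mul_le_mul_of_nonneg_right
    (Finset.single_le_sum (f := fun i => ((x i : ℤ) : ℝ) ^ 2) (fun i _ => sq_nonneg _) (Finset.mem_univ j)) (hg0 x)

/-- **[NoBLE17] Lemma 2.12** ("Fourier transforms and step distributions"), VERBATIM: "For a summable,
non-negative function `g` that is totally rotationally symmetric, as defined in Definition 2.5, the following
bound holds: `Σ_x g(x)[1 − cos(k·x)] ≤ [1 − D̂(k)] Σ_x g(x)‖x‖₂²`."  Symmetry hypothesis in the tree's
`IsZdSymmetric` form; the weighted summability `Σ_x ‖x‖₂² g(x) < ∞` is part of the hypotheses.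
[cite: FitznerVanDerHofstad2016NoBLE, Lemma 2.12 (2.23) (p. 1063); proof App. A (p. 1105)] -/
theorem tsum_mul_one_sub_cos_kdot_le {g : Site d → ℝ} (hg : Summable g) (hg0 : ∀ x, 0 ≤ g x)
    (hgw : Summable fun x => euclidNorm x ^ 2 * g x) (hsym : IsZdSymmetric g) (k : Fin d → ℝ) :
    ∑' x, g x * (1 - Real.cos (kdot k x)) ≤ (1 - Dhat d k) * ∑' x, euclidNorm x ^ 2 * g x := by
  rcases Nat.eq_zero_or_pos d with hd | hd
  · subst hd
    have h0 : ∀ x : Site 0, kdot k x = 0 := fun x => by simp [kdot]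
    simp only [h0, Real.cos_zero, sub_self, mul_zero, tsum_zero]
    exact mul_nonneg (one_sub_Dhat_nonneg k) (tsum_nonneg fun x => mul_nonneg (sq_nonneg _) (hg0 x))
  · haveI : NeZero d := ⟨Nat.pos_iff_ne_zero.mp hd⟩
    have habs : Summable fun x => euclidNorm x ^ 2 * |g x| :=
      hgw.congr fun x => by rw [abs_of_nonneg (hg0 x)]
    have h1 := tsum_mul_one_sub_cos_partial_le hg hg0 hsym k Finset.univ
    have hk : ∀ x : Site d, kdot k x = ∑ j ∈ Finset.univ, k j * (x j : ℝ) := fun x => rfl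
    simp only [hk]
    refine h1.trans ?_
    calc ∑ j, ∑' x, g x * (1 - Real.cos (k j * (x j : ℝ)))
        ≤ ∑ j, (1 - Real.cos (k j)) * ∑' x, ((x j : ℤ) : ℝ) ^ 2 * g x :=
          Finset.sum_le_sum fun j _ => tsum_mul_one_sub_cos_coord_le hg hg0 (summable_sq_coord_mul hg0 hgw) k j
      _ = ∑ j, (1 - Real.cos (k j)) * ((∑' x, euclidNorm x ^ 2 * g x) / d) :=
          Finset.sum_congr rfl fun j _ => by rw [tsum_sq_apply_mul_eq hsym habs j]
      _ = (1 - Dhat d k) * ∑' x, euclidNorm x ^ 2 * g x := by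
          rw [← Finset.sum_mul, one_sub_Dhat]; ring

/-- Lemma 2.12 with the symmetry hypothesis in [NoBLE17]'s own form `IsTRS` (Def. 2.5).
[cite: FitznerVanDerHofstad2016NoBLE, Lemma 2.12 (2.23) (p. 1063)] -/
theorem tsum_mul_one_sub_cos_kdot_le_of_isTRS {g : Site d → ℝ} (hg : Summable g) (hg0 : ∀ x, 0 ≤ g x)
    (hgw : Summable fun x => euclidNorm x ^ 2 * g x) (hT : IsTRS g) (k : Fin d → ℝ) :
    ∑' x, g x * (1 - Real.cos (kdot k x)) ≤ (1 - Dhat d k) * ∑' x, euclidNorm x ^ 2 * g x :=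
  tsum_mul_one_sub_cos_kdot_le hg hg0 hgw hT.isZdSymmetric k

/-- `f̂(0) − f̂(k) = Σ_x [1 − cos(k·x)] f(x)` for summable `f`. [folklore] -/
theorem cosFT_zero_sub_eq_tsum {f : Site d → ℝ} (hf : Summable f) (k : Fin d → ℝ) :
    cosFT f 0 - cosFT f k = ∑' x, (1 - Real.cos (kdot k x)) * f x := by
  rw [cosFT_zero, cosFT, ← hf.tsum_sub (summable_cos_kdot_mul hf k)]
  exact tsum_congr fun x => by ring

/-- Lemma 2.12 in terms of the cosine transform: `ĝ(0) − ĝ(k) ≤ [1 − D̂(k)] Σ_x ‖x‖₂² g(x)`.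
[cite: FitznerVanDerHofstad2016NoBLE, Lemma 2.12 (2.23) (p. 1063)] -/
theorem cosFT_zero_sub_le_of_isTRS {g : Site d → ℝ} (hg : Summable g) (hg0 : ∀ x, 0 ≤ g x)
    (hgw : Summable fun x => euclidNorm x ^ 2 * g x) (hT : IsTRS g) (k : Fin d → ℝ) :
    cosFT g 0 - cosFT g k ≤ (1 - Dhat d k) * ∑' x, euclidNorm x ^ 2 * g x := by
  rw [cosFT_zero_sub_eq_tsum hg, tsum_congr fun x => mul_comm _ (g x)]
  exact tsum_mul_one_sub_cos_kdot_le_of_isTRS hg hg0 hgw hT k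

end Lemma212

/-! ## App. D Step 5: the mechanism of (D.32) -/

section Step5

/-- **App. D Step 5 of [NoBLE17]** (the argument for (D.32)): "we note that `[1 − cos(k·x)] ≥ 0` for all
`k` and `x`" — so if `R ≥ −m` pointwise with `m ≥ 0` summable, totally rotationally symmetric and
`Σ_x ‖x‖₂² m(x) < ∞`, then `R̂(0) − R̂(k) = Σ_x R(x)[1 − cos(k·x)] ≥ −[1 − D̂(k)] Σ_x ‖x‖₂² m(x)` by
Lemma 2.12 applied to `m`.
[cite: FitznerVanDerHofstad2016NoBLE, App. D Step 5, (D.32) (p. 1117); Lemma 2.12 (p. 1063)] -/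
theorem cosFT_zero_sub_ge_of_minorant {R m : Site d → ℝ} (hR : Summable fun x => |R x|)
    (hm : Summable m) (hm0 : ∀ x, 0 ≤ m x) (hmw : Summable fun x => euclidNorm x ^ 2 * m x) (hmT : IsTRS m)
    (hRm : ∀ x, -m x ≤ R x) (k : Fin d → ℝ) :
    -((1 - Dhat d k) * ∑' x, euclidNorm x ^ 2 * m x) ≤ cosFT R 0 - cosFT R k := by
  rw [cosFT_zero_sub_eq_tsum hR.of_abs]
  have h1 : ∑' x, (1 - Real.cos (kdot k x)) * (-m x) ≤ ∑' x, (1 - Real.cos (kdot k x)) * R x := by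
    refine Summable.tsum_le_tsum (fun x => mul_le_mul_of_nonneg_left (hRm x) ?_) ?_ ?_
    · linarith [Real.cos_le_one (kdot k x)]
    · have := (summable_mul_of_nonneg_of_abs_le hm hm0 fun x => abs_one_sub_cos_le_two (kdot k x)).neg
      exact this.congr fun x => by ring
    · exact Summable.of_norm_bounded (hR.mul_left 2) fun x => by
        rw [Real.norm_eq_abs, abs_mul]
        exact mul_le_mul_of_nonneg_right (abs_one_sub_cos_le_two _) (abs_nonneg _)
  have h2 : ∑' x, (1 - Real.cos (kdot k x)) * (-m x) = -∑' x, m x * (1 - Real.cos (kdot k x)) := by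
    rw [← tsum_neg]; exact tsum_congr fun x => by ring
  rw [h2] at h1
  linarith [tsum_mul_one_sub_cos_kdot_le_of_isTRS hm hm0 hmw hmT k]

/-- The (D.32)-shaped conclusion with a constant: if moreover `Σ_x ‖x‖₂² m(x) ≤ β`, then
`−β[1 − D̂(k)] ≤ R̂(0) − R̂(k)` — the form of the last conjunct of `NobleSimplifiedFormAt` (`β = β_{ΔR_F}`,
`R = R_F`). [cite: FitznerVanDerHofstad2016NoBLE, App. D Step 5, (D.32) (p. 1117); Assumption 2.7 (p. 1059)] -/
theorem displacement_lower_bound {R m : Site d → ℝ} (hR : Summable fun x => |R x|)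
    (hm : Summable m) (hm0 : ∀ x, 0 ≤ m x) (hmw : Summable fun x => euclidNorm x ^ 2 * m x) (hmT : IsTRS m)
    (hRm : ∀ x, -m x ≤ R x) {β : ℝ} (hβ : ∑' x, euclidNorm x ^ 2 * m x ≤ β) (k : Fin d → ℝ) :
    -(β * (1 - Dhat d k)) ≤ cosFT R 0 - cosFT R k := by
  have h := cosFT_zero_sub_ge_of_minorant hR hm hm0 hmw hmT hRm k
  have h0 := one_sub_Dhat_nonneg (d := d) k
  nlinarith

end Step5

end Literature.Probability.FitznerVanDerHofstad2017

end
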